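import Summits.QuantumAdvantage.QuantumAdvantage.Theorems.NearExactIsExact.Negative.LevelSixFullCore
import Summits.QuantumAdvantage.QuantumAdvantage.Theorems.NearExactIsExact.Negative.LevelSixMinimalSixtyOne
import Summits.QuantumAdvantage.QuantumAdvantage.Theorems.CubicForrelationNearExactIsExactSecondWeight

/-!
# No level-6 side at `Φ ≥ 61/64` on 14 bits (NearExactIsExact, disprover gen 24)

Negative/structural theorem for the crux `CubicForrelation.NearExactIsExact` (item r2), finite slice `n = 14`.
HONEST FRAMING: a statement about cubic Boolean functions on 14 bits — NOT summit progress; no violation of `NearExactIsExact`.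

`levelSix_false_61c`: if `f, g` are cubic on 14 bits, `W_g = 64u'` with `u'` odd somewhere (the "level-6" side of
`…Negative.ThetaFourteenSixtyOne.even_side_levelSix`), then `Φ(f,g) < 61/64`.  Proof: by `levelSix_odd_card_gt_61c` the odd set
`P` has more than `2¹²` points, so (second weight of `RM(2,14)`, `sw_quadratic_second_weight`) at least `6144`; the budget
`B = Σ (u' − 2(−1)^f)² = 2¹⁷(1 − Φ) ≤ 6144` dominates `#P` termwise, forcing `#P = B = 6144`, `Φ = 61/64`, and a residual
`e = u' − 2(−1)^f` that is `±1` on `P` and `0` off `P` — the TIGHT configuration, whose Fourier `ℓ¹`-norm is at most `6·2¹⁴` by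
`…Negative.LevelSixFullCore.lsf_l1`; but `ê = 256(−1)^g − 2W_f` has `Σ_y (−1)^{g(y)} ê(y) = 2²² − 2·2²¹Φ = 3·2¹⁶ > 6·2¹⁴`.
Consequence (`both_typeO_of_ge_61`): at `n = 14` a cubic pair with `61/64 ≤ Φ < 1` has BOTH sides of type O (all `W/32` odd), i.e. the
value `61/64`, if attained at all, is attained only by the "type T" configuration of `…Negative.TypeOSixtyOneFourteen`.
References: R. O'Donnell (2014) §3.3; F. J. MacWilliams, N. J. A. Sloane (1977) Ch. 15 §2.  Standard axioms only. -/

set_option linter.dupNamespace false -- D-0017: single-problem summit ⇒ `QuantumAdvantage.QuantumAdvantage` by design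

noncomputable section

namespace Summit.QuantumAdvantage.QuantumAdvantage.Theorems.NearExactIsExact.Negative.LevelSixFullSixtyOne

open Finset
open Literature.Computability.QuantumComplexity
open Literature.Computability.QuantumComplexity.BuzetChailloux (signOf_sq)
open Literature.Computability.QuantumComplexity.DerivativeWalsh (W)
open Summit.QuantumAdvantage.QuantumAdvantage.Theorems.CubicForrelation.NearExactIsExact
open Summit.QuantumAdvantage.QuantumAdvantage.Theorems.SignedCubicForrelationNotPrBPP.Negative.HalfQuad (forrelation_comm)
open Summit.QuantumAdvantage.QuantumAdvantage.Theorems.NearExactIsExact.Negative.LevelSixFullCore (lsf_l1)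
open Summit.QuantumAdvantage.QuantumAdvantage.Theorems.NearExactIsExact.Negative.LevelSixMinimalSixtyOne (levelSix_odd_card_gt_61c)

set_option maxHeartbeats 1600000 in
/-- **No level-6 side at `Φ ≥ 61/64` (14 bits).**  `f, g` cubic, `W_g = 64u'` with some `u'(x)` odd, `Φ(f,g) ≥ 61/64` ⇒ `False`.
Finite-slice statement at `n = 14`; NOT summit progress. [this work] -/
theorem levelSix_false_61c (f g : (Fin (7 + 7) → Bool) → Bool) (hf : IsDegLeFun 3 f) (hg : IsDegLeFun 3 g)
    (u' : (Fin (7 + 7) → Bool) → ℤ) (hu' : ∀ x, W (fun y => signOf (g y)) x = (2 : ℝ) ^ 6 * (u' x : ℝ))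
    (hoddg : ∃ x, Odd (u' x)) (hΦ : (61 / 64 : ℝ) ≤ forrelation f g) : False := by
  classical
  obtain ⟨x₁, hx₁⟩ := id hoddg
  have hgt := levelSix_odd_card_gt_61c f g hf hg u' hu' hoddg hΦ
  -- (1) `#P ≥ 6144` (second weight of RM(2,14))
  have hp2 : IsDegLeFun 2 (fun x => decide (Odd (u' x))) :=
    stub_walshTower stub_axParity (7 + 7) 6 2 g u' hg hu' (by intro k hk hkn; omega)
  have hfilt : (univ.filter fun x : Fin (7 + 7) → Bool => decide (Odd (u' x)) = true) = univ.filter fun x => Odd (u' x) :=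
    filter_congr fun x _ => by rw [decide_eq_true_iff]
  have hge : 6144 ≤ #(univ.filter fun x : Fin (7 + 7) → Bool => Odd (u' x)) := by
    by_contra hlt
    have h := sw_quadratic_second_weight (fun x => decide (Odd (u' x))) hp2 ⟨x₁, by simpa using hx₁⟩
      (by rw [hfilt]; norm_num; omega)
    rw [hfilt] at h
    norm_num at h
    omega
  -- (2) the budget `B = 2¹⁷(1 − Φ) ≤ 6144` dominates `#P` termwise
  have hBR := fl_budget6 f g u' hu'
  have hBle : (∑ x, (u' x - 2 * sZ (f x)) ^ 2 : ℤ) ≤ 6144 := by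
    have : ((∑ x, (u' x - 2 * sZ (f x)) ^ 2 : ℤ) : ℝ) ≤ 6144 := by rw [hBR]; linarith
    exact_mod_cast this
  have hpt : ∀ x, (if Odd (u' x) then 1 else 0 : ℤ) ≤ (u' x - 2 * sZ (f x)) ^ 2 := by
    intro x
    by_cases h : Odd (u' x)
    · rw [if_pos h]; exact tp_res_sq_ge_one (tp_sZ_cases (f x)) h
    · rw [if_neg h]; positivity
  have hsumP : (∑ x, (if Odd (u' x) then 1 else 0 : ℤ)) = #(univ.filter fun x : Fin (7 + 7) → Bool => Odd (u' x)) := by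
    rw [sum_boole]
  have hge' : (6144 : ℤ) ≤ #(univ.filter fun x : Fin (7 + 7) → Bool => Odd (u' x)) := by exact_mod_cast hge
  have hsumle : ∑ x, ((u' x - 2 * sZ (f x)) ^ 2 - (if Odd (u' x) then 1 else 0 : ℤ)) ≤ 0 := by
    rw [sum_sub_distrib, hsumP]
    linarith
  have hz : ∀ x ∈ (univ : Finset (Fin (7 + 7) → Bool)), ((u' x - 2 * sZ (f x)) ^ 2 - (if Odd (u' x) then 1 else 0 : ℤ)) = 0 :=
    (sum_eq_zero_iff_of_nonneg fun x _ => by linarith [hpt x]).1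
      (le_antisymm hsumle (sum_nonneg fun x _ => by linarith [hpt x]))
  have hzs : ∑ x, ((u' x - 2 * sZ (f x)) ^ 2 - (if Odd (u' x) then 1 else 0 : ℤ)) = 0 := sum_eq_zero hz
  rw [sum_sub_distrib, hsumP] at hzs
  have hPcard : #(univ.filter fun x : Fin (7 + 7) → Bool => Odd (u' x)) = 6144 := by
    have h1 : (#(univ.filter fun x : Fin (7 + 7) → Bool => Odd (u' x)) : ℤ) ≤ 6144 := by linarith
    have h2 : #(univ.filter fun x : Fin (7 + 7) → Bool => Odd (u' x)) ≤ 6144 := by exact_mod_cast h1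
    omega
  have hon : ∀ x, Odd (u' x) → u' x - 2 * sZ (f x) = 1 ∨ u' x - 2 * sZ (f x) = -1 := by
    intro x hx
    have h := hz x (mem_univ _)
    rw [if_pos hx] at h
    have h1 : (u' x - 2 * sZ (f x) - 1) * (u' x - 2 * sZ (f x) + 1) = 0 := by
      have : (u' x - 2 * sZ (f x)) ^ 2 = 1 := by linarith
      nlinarith [this]
    rcases mul_eq_zero.1 h1 with h2 | h2
    · left; linarith
    · right; linarith
  have hoff : ∀ x, ¬ Odd (u' x) → u' x - 2 * sZ (f x) = 0 := by
    intro x hx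
    have h := hz x (mem_univ _)
    rw [if_neg hx, sub_zero] at h
    exact pow_eq_zero_iff two_ne_zero |>.1 h
  -- (3) `Φ = 61/64` exactly
  have hΦeq : forrelation f g = 61 / 64 := by
    have hBeq : (∑ x, (u' x - 2 * sZ (f x)) ^ 2 : ℤ) = 6144 := by rw [hPcard] at hzs; push_cast at hzs; linarith
    have : ((∑ x, (u' x - 2 * sZ (f x)) ^ 2 : ℤ) : ℝ) = 6144 := by exact_mod_cast hBeq
    rw [hBR] at this
    linarith
  -- (4) the `ℓ¹` bound against the correlation identity
  have hl1 := lsf_l1 f g hg u' hu' hPcard hon hoff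
  have hinv : ∀ y, ∑ x, (u' x : ℝ) * twist x y = 256 * signOf (g y) := by
    intro y
    have h := tz_inversion (fun z => signOf (g z)) y
    rw [sum_congr rfl fun x _ => by rw [hu' x]] at h
    have e : ∑ x, (2 : ℝ) ^ 6 * (u' x : ℝ) * twist x y = 2 ^ 6 * ∑ x, (u' x : ℝ) * twist x y := by
      rw [mul_sum]
      exact sum_congr rfl fun x _ => by ring
    rw [e] at h
    have h' : (2 : ℝ) ^ 6 * (∑ x, (u' x : ℝ) * twist x y - 256 * signOf (g y)) = 0 := by
      rw [mul_sub, h]; norm_num; ring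
    have h2 : (2 : ℝ) ^ 6 ≠ 0 := by positivity
    linarith [(mul_eq_zero.1 h').resolve_left h2]
  have hWE : ∀ y, W (fun x => ((u' x - 2 * sZ (f x) : ℤ) : ℝ)) y = 256 * signOf (g y) - 2 * W (fun x => signOf (f x)) y := by
    intro y
    unfold W
    have e : ∀ x, ((u' x - 2 * sZ (f x) : ℤ) : ℝ) * twist x y = (u' x : ℝ) * twist x y - 2 * (signOf (f x) * twist x y) := by
      intro x
      push_cast
      rw [tp_sZ_cast]
      ring
    rw [sum_congr rfl fun x _ => e x, sum_sub_distrib, ← mul_sum, hinv y]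
  have hcorr : ∑ y, signOf (g y) * W (fun x => signOf (f x)) y = (2 : ℝ) ^ 21 * (61 / 64) := by
    have h := vg_two_pow_mul_forrelation g f
    rw [forrelation_comm, hΦeq] at h
    rw [← h]
  have hone : ∑ y : Fin (7 + 7) → Bool, signOf (g y) ^ 2 = (16384 : ℝ) := by
    rw [sum_congr rfl fun y _ => signOf_sq (g y), sum_const, card_univ]
    simp
  have hbig : ∑ y, signOf (g y) * W (fun x => ((u' x - 2 * sZ (f x) : ℤ) : ℝ)) y = 196608 := by
    have e : ∀ y, signOf (g y) * W (fun x => ((u' x - 2 * sZ (f x) : ℤ) : ℝ)) y =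
        256 * signOf (g y) ^ 2 - 2 * (signOf (g y) * W (fun x => signOf (f x)) y) := by
      intro y; rw [hWE y]; ring
    rw [sum_congr rfl fun y _ => e y, sum_sub_distrib, ← mul_sum, ← mul_sum, hcorr, hone]
    norm_num
  have hle : ∑ y, signOf (g y) * W (fun x => ((u' x - 2 * sZ (f x) : ℤ) : ℝ)) y ≤
      ∑ y, |W (fun x => ((u' x - 2 * sZ (f x) : ℤ) : ℝ)) y| :=
    sum_le_sum fun y _ => by
      cases g y <;> simp only [signOf] <;> norm_num [le_abs_self, neg_le_abs]
  linarith

/-- **At `61/64 ≤ Φ < 1` the transformed side is of type O (14 bits).**  For cubic `f, g` with `61/64 ≤ Φ(f,g) ≠ 1`,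
`W_g = 32u` with every `u(x)` odd (an even side would be at level 6 proper — impossible by `levelSix_false_61c` — or at level
`≥ 7`, where `fo_levelSeven` gives `Φ = 1` or `Φ = 15/16`).  NOT summit progress. [this work] -/
theorem typeO_of_ge_61 (f g : (Fin (7 + 7) → Bool) → Bool) (hf : IsDegLeFun 3 f) (hg : IsDegLeFun 3 g)
    (hΦ : (61 / 64 : ℝ) ≤ forrelation f g) (hne : forrelation f g ≠ 1) :
    ∃ u : (Fin (7 + 7) → Bool) → ℤ, (∀ x, W (fun y => signOf (g y)) x = (2 : ℝ) ^ 5 * (u x : ℝ)) ∧ ∀ x, Odd (u x) := by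
  obtain ⟨u, hu⟩ := tw_base g hg 5 (by norm_num)
  by_cases hall : ∀ x, Odd (u x)
  · exact ⟨u, hu, hall⟩
  · exfalso
    obtain ⟨x₀, hx₀⟩ : ∃ x, ¬ Odd (u x) := by by_contra h; exact hall fun x => not_not.1 fun hx => h ⟨x, hx⟩
    have hev' : ∀ x, ¬ Odd (u x) := fun x h => hx₀ ((fd_parity_const g u hg hu x x₀).1 h)
    have hu6 := tw_level_up g u hu hev'
    by_cases h6 : ∃ x, Odd (u x / 2)
    · exact levelSix_false_61c f g hf hg _ hu6 h6 hΦ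
    · have h6' : ∀ x, ¬ Odd (u x / 2) := fun x hx => h6 ⟨x, hx⟩
      have hu7 := tw_level_up g (fun x => u x / 2) hu6 h6'
      rcases fo_levelSeven f g hf hg _ hu7 (by linarith) with h | h
      · exact hne h
      · linarith [h.2]

/-- **Corollary: at `61/64 ≤ Φ < 1` BOTH sides are of type O (14 bits)** — every `W_g(x)/32` and every `W_f(y)/32` is odd; so the
value `61/64`, if attained by a cubic pair on 14 bits at all, is attained only in the type-T configuration of
`…Negative.TypeOSixtyOneFourteen`.  NOT summit progress. [this work] -/
theorem both_typeO_of_ge_61 (f g : (Fin (7 + 7) → Bool) → Bool) (hf : IsDegLeFun 3 f) (hg : IsDegLeFun 3 g)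
    (hΦ : (61 / 64 : ℝ) ≤ forrelation f g) (hne : forrelation f g ≠ 1) :
    (∃ u : (Fin (7 + 7) → Bool) → ℤ, (∀ x, W (fun y => signOf (g y)) x = (2 : ℝ) ^ 5 * (u x : ℝ)) ∧ ∀ x, Odd (u x)) ∧
    (∃ v : (Fin (7 + 7) → Bool) → ℤ, (∀ y, W (fun x => signOf (f x)) y = (2 : ℝ) ^ 5 * (v y : ℝ)) ∧ ∀ y, Odd (v y)) := by
  refine ⟨typeO_of_ge_61 f g hf hg hΦ hne, typeO_of_ge_61 g f hg hf ?_ ?_⟩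
  · rw [forrelation_comm]; exact hΦ
  · rw [forrelation_comm]; exact hne

end Summit.QuantumAdvantage.QuantumAdvantage.Theorems.NearExactIsExact.Negative.LevelSixFullSixtyOne

end
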